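import Summits.BirchSwinnertonDyer.BirchSwinnertonDyer.Theses.KolyvaginRankRigidityAtTwo
import Summits.BirchSwinnertonDyer.BirchSwinnertonDyer.Theorems.KolyvaginRankRigidityAtTwoKolyvaginCorankLowerBoundAtTwoRichOfLossySwap
import Summits.BirchSwinnertonDyer.BirchSwinnertonDyer.Theorems.KolyvaginRankRigidityAtTwoOffHabitatIrredSwapOfNamedFacts
import Summits.BirchSwinnertonDyer.BirchSwinnertonDyer.Theorems.KolyvaginRankRigidityAtTwoOffHabitatIrredLocalTrivialAtConductor
import Summits.BirchSwinnertonDyer.BirchSwinnertonDyer.Theorems.KolyvaginRankRigidityAtTwoOffHabitatIrredLevelLinks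
import Summits.BirchSwinnertonDyer.BirchSwinnertonDyer.Theorems.KolyvaginRankRigidityAtTwoOffHabitatIrredLocalOrderLevelUp
import Summits.BirchSwinnertonDyer.BirchSwinnertonDyer.Theorems.KolyvaginRankRigidityAtTwoOffHabitatIrredWindowPrime
import Summits.BirchSwinnertonDyer.BirchSwinnertonDyer.Theorems.KolyvaginRankRigidityAtTwoOffHabitatIrredConjSign
import Summits.BirchSwinnertonDyer.BirchSwinnertonDyer.Theorems.KolyvaginRankRigidityAtTwoOffHabitatIrredNonSurjTwoConverseNoTwoTorsionOverKOfIrred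
import HarnessLib

/-!
# Route `KolyvaginRankRigidityAtTwo`, residual crux R_irr `OffHabitatIrredNonSurjTwoConverse`
# (stmt-BirchSwinnertonDyer-27123), LINE 8∞ `kolyvagin_depth_split_inf_irr`, stub V2irr
# `stub_corankLowerBoundAtTwoRichIrr : CorankLowerBoundAtTwoRichIrr` — the corank lower bound at `2` from a RICH seed
# OFF THE HABITAT, modulo TWO NAMED PRINT FACTS (Gross 1991 Prop. 3.7 (2); Serre's open image theorem)
# (width seat krr2-p2 g10; helper, `--supports` 27123)

`corankLowerBoundAtTwoRichIrr_of_prop37 (h37) (hSerre)`: the TEXT of the registered stub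
`Cruxes.OffHabitatIrredNonSurjTwoConverse.KolyvaginDepthSplitInfIrr.CorankLowerBoundAtTwoRichIrr` (V2irr = V2♭∞
`KolyvaginCorankLowerBoundAtTwoRich`, 27984, on R_irr's frame: non-CM, good-ordinary-or-multiplicative at `2`, NOT the
full surjective `2`-adic tower, `E(ℚ)[2] = 0`), VERBATIM (a Theorems file cannot import the Cruxes line file, so the
statement is spelled out; `exact corankLowerBoundAtTwoRichIrr_of_prop37 h37 hSerre` closes the stub by `unfold`).
It is the habitat `kolyvaginCorankLowerBoundAtTwoRich_of_lossySwap` / `…_of_prop37` (p640119 / p641767) RE-THREADED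
through the off-habitat suppliers of krr2-p2 g9/g10 (plug-in table, memo OFFHABITAT-KERNEL v1.3 on 27123):
S1L ↦ `primeSwapAtTwoLossy_offHabitat_of_namedFacts h37 hSerre` (this seat), S2 ↦ `chebotarevOneClassIndexAtTwo_offHabitat
hSerre` (p655785), S3 ↦ `localOrderLevelUpAtTwo_offHabitat` (p654577), S4 ↦ `globalOrderLevelUpAtTwo_offHabitat`
(p654589), T1 ↦ `localTrivialAtConductor_offHabitat_of_frobeniusCongruence h37` (p656912), T2 ↦
`selmerAwayFromConductor_offHabitat` (p654589), T3 ↦ `conjSign_offHabitat` (p651821), `E(K)[2] = 0` ↦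
`KolyvaginRankRigidity.stub_noTwoTorsionOverK_of_irred` (p634161); depth `0` (`depthZero_rich`), the glue
`exists_uniform_theta_k_below`, the lossy swap induction `windowsRich_of_lossySwapTest` (p623984) and the triangular
systems `lowerBound_of_levelTriangularSystems` (p610758) are image-free and reused as landed. No new mathematics.
HONEST FRAMING: CONDITIONAL on the named print facts `GrossLMS1991.prop37_2_frobeniusCongruence` (Gross 1991 Prop. 3.7 (2)
= Nekovář 2007 Prop. 4.9) and `serre_adicImage_contains_congruenceSubgroup` (Serre 1972 / Silverman AEC III.7.9 (a)),
both cite-only in the tree (conditional-result); the registered stub is closed MODULO these two facts only; V1irr (the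
organ, Conj A at `2` off habitat) is untouched; R_irr is NOT closed; the Birch–Swinnerton-Dyer conjecture is NOT proved.
References: Kolyvagin, Math. Ann. 291 (1991) §2 Thm. 2.2–2.3; McCallum, LMS 153 (1991) §5 Prop. 5.2; Gross, LMS 153
(1991) Prop. 3.7 (2), §4; W. Zhang, Camb. J. Math. 2 (2014) Lemma 8.4; Silverman AEC Thm. III.7.9.
-/

set_option autoImplicit false
-- the Theorems namespace of this sub repeats the summit name by design (D-0017 nested layout)
set_option linter.dupNamespace false

noncomputable section

open scoped Classical

open WeierstrassCurve Literature.NumberTheory.EllipticCurves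
  Literature.NumberTheory.EllipticCurves.ModularForms NumberField IsDedekindDomain
open Summit.BirchSwinnertonDyer.BirchSwinnertonDyer.Theses.KolyvaginRankRigidityAtTwo
open Literature.NumberTheory.EllipticCurves.GrossLMS1991 (prop37_2_frobeniusCongruence)

namespace Summit.BirchSwinnertonDyer.BirchSwinnertonDyer.Theorems.KolyvaginLowerBoundAtTwo

/-! ## Positive depth off the habitat (S1L displayed; S2–S4, T1 ⇐ Q2 off habitat ⇐ Gross 3.7 (2), T2, T3 off habitat;
the lossy swap induction and the triangular systems are image-free) -/

/-- **LOWER bound at a RICH depth `ν ≥ 1` with `(θ, k)`-minimality below it, OFF THE HABITAT** — the habitat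
`posDepth_rich_of_lossySwap` VERBATIM with the binder `(∀ m, ρ_{E,2^m} onto)` replaced by `E(ℚ)[2] = 0` and T1, T2, T3,
`E(K)[2] = 0` re-threaded through `localTrivialAtConductor_offHabitat_of_frobeniusCongruence h37`,
`selmerAwayFromConductor_offHabitat`, `conjSign_offHabitat`, `stub_noTwoTorsionOverK_of_irred`; windows from the lossy
swap `hswap`, Čebotarev-with-index `hcheb`, level-ups `hlocUp` / `hglobUp` through `windowsRich_of_lossySwapTest`,
read by `lowerBound_of_levelTriangularSystems`. CONDITIONAL on `h37`.
[cite: Kolyvagin1991MathAnn, §2 Thm. 2.2–2.3] [cite: WZhang2014, Lemma 8.4] [cite: GrossLMS1991, Prop. 3.7 (2)] -/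
theorem posDepth_rich_offHabitat_of_lossySwap (h37 : prop37_2_frobeniusCongruence) (W : WeierstrassCurve ℚ)
    [W.IsElliptic] [W.IsGloballyMinimal] (hCM : ¬ W.HasCM)
    (hred : Rank1Residual.GoodOrd W 2 ∨ Rank1Residual.Mult W 2)
    (htorQ : AddSubgroup.torsionBy W.toAffine.Point (2 : ℤ) = ⊥)
    (K : Type) [Field K] [NumberField K] (hK : IsImaginaryQuadratic K) (hne3 : NumberField.discr K ≠ -3)
    (hne4 : NumberField.discr K ≠ -4) (h2d : ¬ ((2 : ℤ) ∣ NumberField.discr K))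
    [NeZero (W.conductorNorm ℤ)] (hHN : SatisfiesHeegnerHypothesis (W.conductorNorm ℤ) K)
    (Dt : ModularParametrizationData W (W.conductorNorm ℤ)) (β : ℤ) (ι : K →+* ℂ) (c₀ c₁ c₂ : ℕ)
    (hswap :
        ∀ (M I : ℕ) (T : Finset ℕ) (a : ℕ)
          (dat : KolyvaginHeegnerData Dt β ι (∏ p ∈ T, p)) (j : ℕ) (X : Finset ℕ),
          1 ≤ M → M + 1 ≤ I →
          (∀ p ∈ T, Zhang2014.IsKolyvaginPrime (W.conductorNorm ℤ) W K 2 p ∧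
            M + 1 ≤ Zhang2014.kolyvaginIndex W 2 p) →
          a ∈ T → M + c₀ ≤ 2 * j →
          (∀ X' : Finset ℕ, ∃ q : ℕ, q ∉ X' ∧ Zhang2014.IsKolyvaginPrime (W.conductorNorm ℤ) W K 2 q ∧
            I ≤ Zhang2014.kolyvaginIndex W 2 q ∧
            ∃ v : HeightOneSpectrum (𝓞 K), ((q : ℕ) : 𝓞 K) ∈ v.asIdeal ∧
              ((2 ^ j : ℕ) : ℤ) • dat.kolyvaginClass Nat.prime_two M ∉
                (W.baseChange K).torsionLocalKer (v.adicCompletion K) ((2 ^ M : ℕ) : ℤ)) →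
          ∃ ℓ : ℕ, ℓ ∉ X ∧ ℓ ∉ T ∧ Zhang2014.IsKolyvaginPrime (W.conductorNorm ℤ) W K 2 ℓ ∧
            I ≤ Zhang2014.kolyvaginIndex W 2 ℓ ∧
            (∃ v : HeightOneSpectrum (𝓞 K), ((ℓ : ℕ) : 𝓞 K) ∈ v.asIdeal ∧
              ((2 ^ (j - c₂) : ℕ) : ℤ) • dat.kolyvaginClass Nat.prime_two M ∉
                (W.baseChange K).torsionLocalKer (v.adicCompletion K) ((2 ^ M : ℕ) : ℤ)) ∧
            ∃ dat' : KolyvaginHeegnerData Dt β ι (∏ p ∈ insert ℓ (T.erase a), p),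
              (∀ X' : Finset ℕ, ∃ q : ℕ, q ∉ X' ∧ Zhang2014.IsKolyvaginPrime (W.conductorNorm ℤ) W K 2 q ∧
                I ≤ Zhang2014.kolyvaginIndex W 2 q ∧
                ∃ v : HeightOneSpectrum (𝓞 K), ((q : ℕ) : 𝓞 K) ∈ v.asIdeal ∧
                  ((2 ^ (j - c₂) : ℕ) : ℤ) • dat'.kolyvaginClass Nat.prime_two M ∉
                    (W.baseChange K).torsionLocalKer (v.adicCompletion K) ((2 ^ M : ℕ) : ℤ)))
    (hcheb :
        ∀ (n : ℕ) (dat : KolyvaginHeegnerData Dt β ι n) (M m I : ℕ),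
          KolyvaginDescent.KolSupp (Zhang2014.IsKolyvaginPrime (W.conductorNorm ℤ) W K 2) n →
          1 ≤ M → (M : ℕ∞) ≤ Zhang2014.levelIndex W 2 n → M ≤ I → c₁ ≤ m →
          ((2 ^ m : ℕ) : ℤ) • dat.kolyvaginClass Nat.prime_two M ≠ 0 →
          (∀ X' : Finset ℕ, ∃ q : ℕ, q ∉ X' ∧ Zhang2014.IsKolyvaginPrime (W.conductorNorm ℤ) W K 2 q ∧
            I ≤ Zhang2014.kolyvaginIndex W 2 q ∧
            ∃ v : HeightOneSpectrum (𝓞 K), ((q : ℕ) : 𝓞 K) ∈ v.asIdeal ∧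
              ((2 ^ (m - c₁) : ℕ) : ℤ) • dat.kolyvaginClass Nat.prime_two M ∉
                (W.baseChange K).torsionLocalKer (v.adicCompletion K) ((2 ^ M : ℕ) : ℤ)))
    (hlocUp :
        ∀ (n : ℕ) (dat : KolyvaginHeegnerData Dt β ι n) (M M' j q : ℕ)
          (v : HeightOneSpectrum (𝓞 K)),
          KolyvaginDescent.KolSupp (Zhang2014.IsKolyvaginPrime (W.conductorNorm ℤ) W K 2) n →
          1 ≤ M → M ≤ M' → (M' : ℕ∞) ≤ Zhang2014.levelIndex W 2 n →
          Zhang2014.IsKolyvaginPrime (W.conductorNorm ℤ) W K 2 q → M' ≤ Zhang2014.kolyvaginIndex W 2 q →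
          ¬ q ∣ n → ((q : ℕ) : 𝓞 K) ∈ v.asIdeal →
          ((2 ^ j : ℕ) : ℤ) • dat.kolyvaginClass Nat.prime_two M ∉
            (W.baseChange K).torsionLocalKer (v.adicCompletion K) ((2 ^ M : ℕ) : ℤ) →
          ((2 ^ (j + (M' - M)) : ℕ) : ℤ) • dat.kolyvaginClass Nat.prime_two M' ∉
            (W.baseChange K).torsionLocalKer (v.adicCompletion K) ((2 ^ M' : ℕ) : ℤ))
    (hglobUp :
        ∀ (n : ℕ) (dat : KolyvaginHeegnerData Dt β ι n) (M M' j : ℕ),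
          KolyvaginDescent.KolSupp (Zhang2014.IsKolyvaginPrime (W.conductorNorm ℤ) W K 2) n →
          1 ≤ M → M ≤ M' → (M' : ℕ∞) ≤ Zhang2014.levelIndex W 2 n →
          ((2 ^ j : ℕ) : ℤ) • dat.kolyvaginClass Nat.prime_two M ≠ 0 →
          ((2 ^ (j + (M' - M)) : ℕ) : ℤ) • dat.kolyvaginClass Nat.prime_two M' ≠ 0) :
    ∀ ν : ℕ, 1 ≤ ν →
      (∀ θ k : ℕ, ∃ (n : ℕ) (d : KolyvaginHeegnerData Dt β ι n) (M : ℕ),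
        KolyvaginDescent.KolSupp (Zhang2014.IsKolyvaginPrime (W.conductorNorm ℤ) W K 2) n ∧
        n.primeFactors.card = ν ∧ 1 ≤ M ∧ ((θ * M + k : ℕ) : ℕ∞) ≤ Zhang2014.levelIndex W 2 n ∧
        d.kolyvaginClass Nat.prime_two M ≠ 0) →
      (∃ θ k : ℕ, ∀ (n' : ℕ) (d' : KolyvaginHeegnerData Dt β ι n') (M' : ℕ),
        KolyvaginDescent.KolSupp (Zhang2014.IsKolyvaginPrime (W.conductorNorm ℤ) W K 2) n' →
        1 ≤ M' → ((θ * M' + k : ℕ) : ℕ∞) ≤ Zhang2014.levelIndex W 2 n' →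
        n'.primeFactors.card < ν → d'.kolyvaginClass Nat.prime_two M' = 0) →
      (ν + 1 ≤ W.selmerCorank 2 ∨ ν + 1 ≤ (W.quadraticTwist (NumberField.discr K : ℚ)).selmerCorank 2) := by
  intro ν hpos hrich hmin
  set N := W.conductorNorm ℤ with hNdef
  haveI : Fact (Nat.Prime 2) := ⟨Nat.prime_two⟩
  -- windows at every level (landed lossy swap induction with a rich seed)
  have hWin := windowsRich_of_lossySwapTest W K Dt β ι c₀ c₁ c₂ hswap hcheb hlocUp hglobUp ν hpos hrich hmin
  -- the quadratic field: `K = ℚ(θ)`, `θ² = d_K`, `σ₀` its non-trivial automorphism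
  obtain ⟨θ, hθ, hc⟩ := exists_sq_eq_discr_not_mem_range K hK.1
  set σ₀ := sigmaQ K hK.1 hθ hc with hσ₀
  have hσ₀1 : σ₀ ≠ 1 := sigmaQ_ne_one K hK.1 hθ hc
  -- the other stubs / landed pieces on this frame
  have hT1 := localTrivialAtConductor_offHabitat_of_frobeniusCongruence h37 W hCM hred htorQ K hK hne3 hne4 h2d
    hHN Dt β ι
  obtain ⟨t, hT2⟩ := selmerAwayFromConductor_offHabitat W hCM hred htorQ K hK hne3 hne4 h2d hHN Dt β ι
  obtain ⟨f, dd, hνf, hT5⟩ := hWin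
  obtain ⟨ε, hε1, hT3⟩ := conjSign_offHabitat W hCM hred htorQ K hK hne3 hne4 h2d hHN Dt β ι σ₀ hσ₀1 f
  -- `E(K)[2] = 0` off the habitat (landed stub `stub_noTwoTorsionOverK_of_irred`, p634161)
  have htor : AddSubgroup.torsionBy (W.baseChange K).toAffine.Point (2 : ℤ) = ⊥ :=
    KolyvaginRankRigidity.stub_noTwoTorsionOverK_of_irred W htorQ K hK
  -- it suffices to bound by `f + 1 ≥ ν + 1`
  suffices h : f + 1 ≤ W.selmerCorank 2 ∨
      f + 1 ≤ (W.quadraticTwist (NumberField.discr K : ℚ)).selmerCorank 2 by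
    rcases h with h | h
    · exact Or.inl (le_trans (by omega) h)
    · exact Or.inr (le_trans (by omega) h)
  -- the level-`2^M'` triangular systems at depth `f`
  refine lowerBound_of_levelTriangularSystems W K hK.1 hθ hc htor f (dd + t) ε hε1 fun M' ↦ ?_
  rcases Nat.eq_zero_or_pos M' with hM'0 | hM'pos
  · subst hM'0
    obtain ⟨-, -, v₁, -, -⟩ := hT5 1 le_rfl
    refine ⟨fun _ ↦ 0, v₁, fun _ ↦ zero_mem _, fun _ ↦ by rw [map_zero, zsmul_zero],
      fun _ _ _ ↦ zero_mem _, fun _ e he ↦ absurd he (by omega)⟩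
  obtain ⟨S, q, v, dat, hcard, hprimes, hinc, hqv, hvan0, hdiag⟩ := hT5 M' hM'pos
  -- facts on the window conductors
  have hSprime : ∀ i, ∀ p ∈ S i, p.Prime := fun i p hp ↦ (hprimes i p hp).1.1
  have hpf : ∀ i, (∏ p ∈ S i, p).primeFactors = S i := fun i ↦ Nat.primeFactors_prod (hSprime i)
  have hsq : ∀ i, Squarefree (∏ p ∈ S i, p) := fun i ↦ by
    refine Finset.squarefree_prod_of_pairwise_isCoprime (fun a ha b hb hab ↦ ?_)
      fun p hp ↦ (hSprime i p hp).squarefree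
    simp only [← Nat.coprime_iff_isRelPrime]
    exact (Nat.coprime_primes (hSprime i a ha) (hSprime i b hb)).mpr hab
  have hsupp : ∀ i, KolyvaginDescent.KolSupp (Zhang2014.IsKolyvaginPrime N W K 2) (∏ p ∈ S i, p) :=
    fun i ↦ ⟨hsq i, fun p hp ↦ (hprimes i p (by rwa [hpf i] at hp)).1⟩
  have hlev1 : ∀ i, ((M' + 1 : ℕ) : ℕ∞) ≤ Zhang2014.levelIndex W 2 (∏ p ∈ S i, p) := fun i ↦ by
    rw [Zhang2014.natCast_le_levelIndex_iff]
    intro p hp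
    rw [hpf i] at hp
    exact (hprimes i p hp).2
  have hlev : ∀ i, ((M' : ℕ) : ℕ∞) ≤ Zhang2014.levelIndex W 2 (∏ p ∈ S i, p) := fun i ↦
    le_trans (by exact_mod_cast Nat.le_succ M') (hlev1 i)
  -- T1 at every prime `ℓ ∣ n_i` (vanishing of the classes of conductor `n_i/ℓ` supplied by the windows)
  have hloc : ∀ i, ∀ ℓ ∈ S i, ∀ w : HeightOneSpectrum (𝓞 K), ((ℓ : ℕ) : 𝓞 K) ∈ w.asIdeal →
      (dat i).kolyvaginClass Nat.prime_two M' ∈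
        (W.baseChange K).torsionLocalKer (w.adicCompletion K) ((2 ^ M' : ℕ) : ℤ) :=
    fun i ℓ hℓ w hw ↦ hT1 _ (dat i) M' ℓ (hsupp i) hM'pos (hlev1 i) (by rw [hpf i]; exact hℓ)
      (hvan0 i ℓ hℓ) w hw
  -- the classes
  refine ⟨fun i ↦ ((2 ^ t : ℕ) : ℤ) • (dat i).kolyvaginClass Nat.prime_two M', v, ?_, ?_, ?_, ?_⟩
  · -- Selmer
    intro i
    rw [mem_selmerGroup_iff]
    refine ⟨fun w ↦ ?_, fun w ↦ ?_⟩
    · by_cases hw : (((∏ p ∈ S i, p : ℕ) : ℕ) : 𝓞 K) ∈ w.asIdeal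
      · rw [Nat.cast_prod] at hw
        obtain ⟨ℓ, hℓ, hℓw⟩ := Ideal.IsPrime.prod_mem_iff.mp hw
        exact AddSubgroup.zsmul_mem _
          ((W.baseChange K).torsionLocalKer_le_selmerLocalKer _ _ (hloc i ℓ hℓ w hℓw)) _
      · exact hT2 _ (dat i) M' (hsupp i) hM'pos (hlev i) w hw
    · haveI : IsAlgClosed w.Completion := isAlgClosed_of_ringEquiv
        (InfinitePlace.Completion.ringEquivComplexOfIsComplex (hK.2.isComplex w)).symm
      rw [WeierstrassCurve.selmerLocalKer_eq_top_of_isAlgClosed]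
      trivial
  · -- eigen
    intro i
    rw [map_zsmul, hT3 _ (dat i) M' (hsupp i) (by rw [hpf i, hcard i]) hM'pos (hlev i),
      smul_comm]
  · -- triangular
    intro i j hij
    exact AddSubgroup.zsmul_mem _ (hloc i (q j) (hinc i j hij) (v j) (hqv j)) _
  · -- diagonal
    intro i e he hmem
    refine hdiag i (e + t) (by omega) ?_
    rw [pow_add, Nat.cast_mul, ← smul_smul]
    exact hmem

/-! ## V2irr: the registered text, modulo the two named print facts -/

/-- **V2irr `CorankLowerBoundAtTwoRichIrr` (registered stub `stub_corankLowerBoundAtTwoRichIrr` of LINE 8∞ on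
stmt-BirchSwinnertonDyer-27123; its text VERBATIM) from Gross 1991 Prop. 3.7 (2) (`h37`) and Serre's open image
theorem (`hSerre`).** Kolyvagin's corank lower bound at `2`, rich form, on R_irr's frame (`E(ℚ)[2] = 0`, `2`-adic image
of finite index): a rich seed of depth `ν` with every class of smaller depth killed by some margin forces
`ν + 1 ≤ corank_{ℤ₂} Sel_{2^∞}(E/ℚ)` or `ν + 1 ≤ corank_{ℤ₂} Sel_{2^∞}(E^{(d_K)}/ℚ)`. Proof = the habitat
`kolyvaginCorankLowerBoundAtTwoRich_of_lossySwap` re-threaded: S1L off habitat (`primeSwapAtTwoLossy_offHabitat_of_namedFacts`),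
S2/S3/S4 off habitat, `posDepth_rich_offHabitat_of_lossySwap`, `depthZero_rich`, `exists_uniform_theta_k_below`.
CONDITIONAL on the two named print facts (conditional-result); the hypothesis `¬ (∀ m, ρ_{E,2^m} onto)` of the text
is not used (the proof runs at any finite index). R_irr is not closed by this; BSD is NOT proved.
[cite: Kolyvagin1991MathAnn, §2 Thm. 2.2, p. 257, p. 259 (2.1)] [cite: McCallumLMS1991, §5 Prop. 5.2]
[cite: GrossLMS1991, Prop. 3.7 (2)] [cite: SilvermanAEC2009, Thm. III.7.9 (a)] -/
theorem corankLowerBoundAtTwoRichIrr_of_prop37 (h37 : prop37_2_frobeniusCongruence)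
    (hSerre : serre_adicImage_contains_congruenceSubgroup) :
    ∀ (W : WeierstrassCurve ℚ) [W.IsElliptic] [W.IsGloballyMinimal], ¬ W.HasCM → (Literature.NumberTheory.EllipticCurves.Rank1Residual.GoodOrd W 2 ∨ Literature.NumberTheory.EllipticCurves.Rank1Residual.Mult W 2) → ¬ (∀ m : ℕ, W.HasSurjectiveModNGaloisRep (2 ^ m : ℕ)) → AddSubgroup.torsionBy W.toAffine.Point (2 : ℤ) = ⊥ → ∀ (K : Type) [Field K] [NumberField K], Literature.NumberTheory.EllipticCurves.IsImaginaryQuadratic K → NumberField.discr K ≠ -3 → NumberField.discr K ≠ -4 → ¬ ((2 : ℤ) ∣ NumberField.discr K) → ∀ [NeZero (W.conductorNorm ℤ)], Literature.NumberTheory.EllipticCurves.SatisfiesHeegnerHypothesis (W.conductorNorm ℤ) K → ∀ (Dt : Literature.NumberTheory.EllipticCurves.ModularForms.ModularParametrizationData W (W.conductorNorm ℤ)) (β : ℤ) (ι : K →+* ℂ) (ν : ℕ), (∀ θ k : ℕ, ∃ (n : ℕ) (d : Literature.NumberTheory.EllipticCurves.KolyvaginHeegnerData Dt β ι n) (M :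 ℕ), Literature.NumberTheory.EllipticCurves.KolyvaginDescent.KolSupp (Literature.NumberTheory.EllipticCurves.Zhang2014.IsKolyvaginPrime (W.conductorNorm ℤ) W K 2) n ∧ n.primeFactors.card = ν ∧ 1 ≤ M ∧ ((θ * M + k : ℕ) : ℕ∞) ≤ Literature.NumberTheory.EllipticCurves.Zhang2014.levelIndex W 2 n ∧ d.kolyvaginClass Nat.prime_two M ≠ 0) → (∀ ν' : ℕ, ν' < ν → ∃ θ k : ℕ, ∀ (n' : ℕ) (d' : Literature.NumberTheory.EllipticCurves.KolyvaginHeegnerData Dt β ι n') (M' : ℕ), Literature.NumberTheory.EllipticCurves.KolyvaginDescent.KolSupp (Literature.NumberTheory.EllipticCurves.Zhang2014.IsKolyvaginPrime (W.conductorNorm ℤ) W K 2) n' → 1 ≤ M' → ((θ * M' + k : ℕ) : ℕ∞) ≤ Literature.NumberTheory.EllipticCurves.Zhang2014.levelIndex W 2 n' → n'.primeFactors.card = ν' → d'.kolyvaginClass Nat.prime_two M' = 0) → (ν + 1 ≤ W.selmerCorank 2 ∨ ν + 1 ≤ (W.quadraticTwist (NumberField.discr K : ℚ)).selmerCorank 2)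 := by
  intro W _ _ hCM hred _hns htorQ K _ _ hK hne3 hne4 h2d _ hHN Dt β ι ν hrich hbelow
  obtain ⟨c₀, c₂, hS1⟩ :=
    primeSwapAtTwoLossy_offHabitat_of_namedFacts h37 hSerre W hCM hred htorQ K hK hne3 hne4 h2d hHN
  obtain ⟨c₁, hS2⟩ := chebotarevOneClassIndexAtTwo_offHabitat hSerre W hCM hred htorQ K hK hne3 hne4 h2d hHN
  rcases Nat.eq_zero_or_pos ν with h0 | hpos
  · subst h0
    obtain ⟨n, d, M, hn, hcard, -, -, hne⟩ := hrich 0 0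
    have h := depthZero_rich W K hK hHN Dt β ι n d M hn hne hcard
    rwa [hcard] at h
  · -- one `(θ, k)` for all depths below `ν`
    obtain ⟨θ, k, hθk⟩ := exists_uniform_theta_k_below
      (P := fun ν' θ k ↦ ∀ (n' : ℕ) (d' : KolyvaginHeegnerData Dt β ι n') (M' : ℕ),
        KolyvaginDescent.KolSupp (Zhang2014.IsKolyvaginPrime (W.conductorNorm ℤ) W K 2) n' →
        1 ≤ M' → ((θ * M' + k : ℕ) : ℕ∞) ≤ Zhang2014.levelIndex W 2 n' →
        n'.primeFactors.card = ν' → d'.kolyvaginClass Nat.prime_two M' = 0)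
      (fun ν' θ k θ' k' hθ hk h n' d' M' hn' hM' hle hcard ↦ h n' d' M' hn' hM'
        (le_trans (by exact_mod_cast (by nlinarith : θ * M' + k ≤ θ' * M' + k')) hle) hcard) hbelow
    exact posDepth_rich_offHabitat_of_lossySwap h37 W hCM hred htorQ K hK hne3 hne4 h2d hHN Dt β ι c₀ c₁ c₂
      (hS1 Dt β ι) (hS2 Dt β ι)
      (localOrderLevelUpAtTwo_offHabitat W hCM hred htorQ K hK hne3 hne4 h2d hHN Dt β ι)
      (globalOrderLevelUpAtTwo_offHabitat W hCM hred htorQ K hK hne3 hne4 h2d hHN Dt β ι)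
      ν hpos hrich ⟨θ, k, fun n' d' M' hn' hM' hle hlt ↦ hθk _ hlt n' d' M' hn' hM' hle rfl⟩

end Summit.BirchSwinnertonDyer.BirchSwinnertonDyer.Theorems.KolyvaginLowerBoundAtTwo

end
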